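/-
Copyright (c) 2026. All rights reserved.
Released under Apache 2.0 license as described in the file LICENSE.
Authors: abc-iut cell, wave-2 seat abc-iut-L3-t10 (gen 3; proof-only; row «LD-REPAIR»: the kernel certificate O-LD-1
on abc-iut-L3-t11's v1 `LevelDictionary`).
-/
import Literature.AnabelianGeometry.SemiGraphs.TemperedLevelDictionary
import Literature.AnabelianGeometry.SemiGraphs.TemperedVerticialNamedFactsProofs
import HarnessLib

/-!
# [SemiAnbd] Thm 3.7 (iii): why the v1 level dictionary cannot be instantiated at orbit-graph levels (O-LD-1)

Mochizuki, *Semi-graphs of anabelioids*, Publ. RIMS **42** (2006) [MochizukiSemiAnbd2006], Thm 3.7 (iii) pp. 40–41,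
Remark 2.2.1 p. 24; Thm 3.7 (i) p. 40 (the verticial homomorphisms `Π_v → π₁^temp(G)` are injective).

PROOF-ONLY kernel certificate of the cell's negative booking O-LD-1 (finding F-t10g3-1, seat abc-iut-L3-t10 gen 3;
ruling α5-1 of abc-iut-L3-lead): the fields `qAct_ιQ`, `ker_qAct_trivial`, `ιQ_injective` of abc-iut-L3-t11's v1
`LevelDictionary` (`TemperedLevelDictionary.lean`, untouched) make `π₁^temp(𝒢)` act FAITHFULLY on the system of
finite level GRAPHS `𝔾_j`:

* `LevelDictionary.eq_one_of_forall_levelAct`, `LevelDictionary.levelActs_injective`;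
* `LevelDictionary.subsingleton_of_subsingleton_aut` — trivial `Aut 𝔾_j` for all `j` forces `π₁^temp(𝒢) = 1`;
* `LevelDictionary.subsingleton_Gv_of_subsingleton_aut`, `LevelDictionary.subsingleton_Gv_of_edgeless` — under the
  hypotheses of Thm 3.7 every `Π_v` injects into `π₁^temp(𝒢)` (`verticialInjective_holds`), so over an EDGELESS `𝒢`
  a v1 dictionary whose levels have at most one vertex each (the underlying graphs of connected coverings of a
  one-vertex `𝒢`) forces every `Π_v = 1`; with `Π_v = Aff(ℤ_p)` (the tree's witness `affWitness` of
  `Thm37Hypotheses`) no such dictionary exists.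

Print uses the kernels of the actions on the finite étale Galois COVERINGS, which meet in `1` (Prop. 3.6 (iii));
the repaired interfaces are `CovLevelDictionary` / `GoodLevelDictionary` and
`stabBranchPair'_of_coveringDictionary(')`. Nothing here takes a side on [IUTchIII] Cor. 3.12.
-/

namespace Literature.AnabelianGeometry.SemiGraphs

/-- A semi-graph with at most one vertex and no edges has only the identity automorphism. [cite: MochizukiSemiAnbd2006, §1 p.11] -/
theorem SemiGraph.subsingleton_aut_of_subsingleton_of_isEmpty (G : SemiGraph)
    [Subsingleton G.Vertex] [IsEmpty G.Edge] : Subsingleton (CategoryTheory.Aut G) := by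
  haveI : IsEmpty G.Branch := ⟨fun b => IsEmpty.false (G.edgeOf b)⟩
  refine ⟨fun σ τ => CategoryTheory.Iso.ext (SemiGraph.hom_ext _ _ ?_ ?_ ?_)⟩
  · exact funext fun _ => Subsingleton.elim _ _
  · exact funext fun e => (IsEmpty.false e).elim
  · exact funext fun b => (IsEmpty.false b).elim

namespace ProfiniteSemiGraph

open Topology

universe v u

variable {𝒢 : ProfiniteSemiGraph.{u}}

/-! ### The certificate O-LD-1 on the v1 dictionary -/

namespace LevelDictionary

variable {c : TemperedPiChart 𝒢} (X : LevelDictionary.{v} 𝒢 c)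

/-- **O-LD-1, kernel certificate**: the fields `qAct_ιQ`, `ker_qAct_trivial`, `ιQ_injective` of a v1
`LevelDictionary` force every element of `π₁^temp(𝒢)` acting trivially on ALL the finite level graphs `𝔾_j` to
be trivial. [cite: MochizukiSemiAnbd2006, Rmk. 2.2.1 p.24] -/
theorem eq_one_of_forall_levelAct (g : c.G) (hg : ∀ j, X.levelAct j g = 1) : g = 1 := by
  apply X.ιQ_injective
  rw [map_one]
  exact X.ker_qAct_trivial _ fun j => by rw [MonoidHom.mem_ker, X.qAct_ιQ, hg]

/-- **O-LD-1**: a v1 `LevelDictionary` makes `π₁^temp(𝒢)` act FAITHFULLY on the system of finite level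
graphs. [cite: MochizukiSemiAnbd2006, Rmk. 2.2.1 p.24] -/
theorem levelActs_injective : Function.Injective fun (g : c.G) (j : X.J) => X.levelAct j g := by
  intro g h hgh
  have h1 : g * h⁻¹ = 1 := X.eq_one_of_forall_levelAct _ fun j => by
    have hj := congrFun hgh j
    dsimp only at hj
    rw [map_mul, map_inv, hj, mul_inv_cancel]
  exact mul_inv_eq_one.mp h1

/-- **O-LD-1**: if all the level graphs of a v1 `LevelDictionary` have trivial automorphism groups, the
chart group `π₁^temp(𝒢)` is trivial. [cite: MochizukiSemiAnbd2006, Rmk. 2.2.1 p.24] -/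
theorem subsingleton_of_subsingleton_aut (h : ∀ j, Subsingleton (CategoryTheory.Aut (X.level j))) :
    Subsingleton c.G :=
  ⟨fun _ _ => X.levelActs_injective (funext fun _ => Subsingleton.elim _ _)⟩

/-- **O-LD-1, under the hypotheses of Thm. 3.7**: then every vertex group `Π_v` is trivial too, since
`Π_v ↪ π₁^temp(𝒢)` through a verticial homomorphism (Thm. 3.7 (i), `verticialInjective_holds`).
[cite: MochizukiSemiAnbd2006, Thm 3.7(i) p.40] -/
theorem subsingleton_Gv_of_subsingleton_aut (h𝒢 : 𝒢.Thm37Hypotheses)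
    (h : ∀ j, Subsingleton (CategoryTheory.Aut (X.level j))) (v : 𝒢.graph.Vertex) :
    Subsingleton (𝒢.Gv v) := by
  haveI := X.subsingleton_of_subsingleton_aut h
  obtain ⟨⟨_, φ, hφ, rfl⟩, hinj⟩ := verticialInjective_holds 𝒢 h𝒢 c v
  exact ⟨fun _ _ => hinj φ hφ (Subsingleton.elim _ _)⟩

/-- **O-LD-1, the edgeless case** (the cell's note N-t6g2-2): over an EDGELESS `𝒢` satisfying the hypotheses
of Thm. 3.7, a v1 `LevelDictionary` whose finite levels have at most one vertex each (e.g. the underlying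
graphs of CONNECTED coverings of a one-vertex `𝒢`) forces every vertex group `Π_v` to be trivial — so no such
dictionary exists as soon as some `Π_v ≠ 1` (e.g. `Π_v = Aff(ℤ_p)`, the tree's witness of `Thm37Hypotheses`).
[cite: MochizukiSemiAnbd2006, Thm 3.7(iii) p.41] -/
theorem subsingleton_Gv_of_edgeless (h𝒢 : 𝒢.Thm37Hypotheses) [IsEmpty 𝒢.graph.Edge]
    (hV : ∀ j, Subsingleton (X.level j).Vertex) (v : 𝒢.graph.Vertex) : Subsingleton (𝒢.Gv v) := by
  haveI : ∀ j, IsEmpty (X.level j).Edge := fun j => ⟨fun e => IsEmpty.false ((X.levelProj j).edgeMap e)⟩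
  exact X.subsingleton_Gv_of_subsingleton_aut h𝒢
    (fun j => (X.level j).subsingleton_aut_of_subsingleton_of_isEmpty) v

end LevelDictionary

end ProfiniteSemiGraph

end Literature.AnabelianGeometry.SemiGraphs
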